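import Mathlib
import HarnessLib

/-!
# K6 crux `MuTransfer` (stmt-BirchSwinnertonDyer-19629 / promoted stub_x9 = stmt-BirchSwinnertonDyer-19276
# `MuTransferX9`): MU-TRANSFER-PROOF (F8) — Sah's lemma and the injectivity of restriction to `G_{L₀}`,
# kernel-checked at cochain level

Cell `bsd-smallim`, seat `bsd-smallim-k6-c2` (D-0074 group (F)). HONEST FRAMING: theorems only (no
definition, no named fact, D-0026); pure algebra of `1`-cocycles `G → M` for an abstract group `G`;
nothing is asserted about any curve and nothing is booked. Sixth KERNEL file toward Theorem A of
HOME/koly/MU-TRANSFER-PROOF.md (KOLY-MEMO Thm. 5.7.1).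

(F8) of the memo: with `L₀ = ℚ(E[p], μ_{p^{m₀}})`, the element `z₀ = (λ̄·1, ω̃(λ̄²)) ∈ Gal(L₀/ℚ)` is
central and acts on `𝒯_e` and on `𝒯_e^*` by the scalar `λ̄ ≠ 1` of (F2) (and trivially on
`A_e(χ^{±1})`), while `G_{L₀}` acts trivially on `𝒯_e`, `𝒯_e^*`; "so [Sah] `H¹(Gal(L₀/ℚ), 𝒯_e) = 0`, and
restriction `H¹(G_S, 𝒯_e) → Hom_G(G_{L₀}, 𝒯_e)` is INJECTIVE". This file proves the cochain statement
behind both sentences at once, for an abstract group `G`, a subgroup `N` (`= G_{L₀} ∩ G_S`-image)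
acting trivially on the module `M`, and an element `z` central modulo `N` acting as an invertible-minus-one
scalar:

* `cocycle_eq_coboundary_of_central_scalar` — **Sah + inflation–restriction in one line**: a
  `1`-cocycle `c : G → M` vanishing on `N` is the coboundary of `m = (λ − 1)⁻¹·c(z)`:
  `c(g) = ρ(g)m − m`. (From `c(zg) = c(gzn')`: `(λ − 1)c(g) = (ρ(g) − 1)c(z)`.)
* `restriction_injective_of_central_scalar` — hence two cocycles with the same restriction to `N`
  differ by a coboundary (the injectivity of `H¹(G, M) → Hom(N, M)` used in Step 1 to read the
  classes `κ'_e`, `y_e` as `G`-equivariant homomorphisms `h, h^*` on `G_{L₀}`).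

References: HOME/koly/MU-TRANSFER-PROOF.md §1 (F8), §5 Step 1; C.-H. Sah, *Automorphisms of finite
groups*, J. Algebra 10 (1968) (the lemma); S. Lang, *Fundamentals of Diophantine Geometry*, /
K. Rubin, *Euler Systems* (2000) Lemma 4.1.3-type use; B. Mazur, K. Rubin, Mem. AMS 799 (2004)
Lemma 3.5.2 (the same vanishing under hypothesis (H.3)).
-/

-- the summit and its single problem are both named `BirchSwinnertonDyer` (registry layout D-0017)
set_option linter.dupNamespace false

set_option autoImplicit false

namespace Summit.BirchSwinnertonDyer.BirchSwinnertonDyer.Rank1Residual.KolyvaginClass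

variable {Ω : Type*} [CommRing Ω] {M : Type*} [AddCommGroup M] [Module Ω M]
  {G : Type*} [Group G] (ρ : G →* (M →ₗ[Ω] M))

/-- **Sah's lemma with inflation–restriction, cochain form (MU-TRANSFER-PROOF (F8)).** Let
`c : G → M` be a `1`-cocycle (`c(gh) = c(g) + ρ(g)c(h)`) vanishing on a subgroup `N` (in the memo
`N = G_{L₀}` acts trivially on `M`; at cochain level only `c|_N = 0` is used), and let `z ∈ G` be
central modulo `N` (`zg ∈ gzN` for all `g`) and act on `M` as
a scalar `λ` with `λ − 1` a unit. Then `c` is the coboundary of `m = (λ − 1)⁻¹·c(z)`: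
`c(g) = ρ(g)m − m` for all `g`. [folklore] -/
theorem cocycle_eq_coboundary_of_central_scalar (c : G → M)
    (hc : ∀ g h : G, c (g * h) = c g + ρ g (c h))
    (N : Subgroup G) (hcN : ∀ n ∈ N, c n = 0)
    (z : G) (hz : ∀ g : G, ∃ n ∈ N, z * g = g * z * n)
    (lam : Ωˣ) (hρz : ∀ m : M, ρ z m = (lam : Ω) • m) (hlam : IsUnit ((lam : Ω) - 1)) :
    ∀ g : G, c g = ρ g (hlam.unit⁻¹.val • c z) - hlam.unit⁻¹.val • c z := by
  intro g
  obtain ⟨n, hn, hzg⟩ := hz g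
  -- `c(zg) = c(z) + λ c(g)` and `c(gzn) = c(g) + ρ(g) c(z)`
  have h1 : c (z * g) = c z + (lam : Ω) • c g := by rw [hc, hρz]
  have h2 : c (g * z * n) = c g + ρ g (c z) := by
    rw [hc, hcN n hn, map_zero, add_zero, hc]
  rw [hzg] at h1
  -- `(λ - 1) • c g = (ρ g - 1) (c z)`
  have hkey : ((lam : Ω) - 1) • c g = ρ g (c z) - c z := by
    rw [sub_smul, one_smul]
    have := h1.symm.trans h2
    -- `c z + λ • c g = c g + ρ g (c z)`
    calc (lam : Ω) • c g - c g = (c z + (lam : Ω) • c g) - c g - c z := by abel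
      _ = (c g + ρ g (c z)) - c g - c z := by rw [this]
      _ = ρ g (c z) - c z := by abel
  -- divide by the unit `λ - 1`
  set u := hlam.unit⁻¹.val with hu
  have huinv : u * ((lam : Ω) - 1) = 1 := by
    rw [hu]
    exact hlam.unit.inv_mul
  calc c g = (u * ((lam : Ω) - 1)) • c g := by rw [huinv, one_smul]
    _ = u • (((lam : Ω) - 1) • c g) := by rw [mul_smul]
    _ = u • (ρ g (c z) - c z) := by rw [hkey]
    _ = ρ g (u • c z) - u • c z := by rw [smul_sub, map_smul]

/-- **Injectivity of restriction modulo coboundaries (MU-TRANSFER-PROOF (F8), the sentence used in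
Step 1).** In the situation of `cocycle_eq_coboundary_of_central_scalar`, two `1`-cocycles
`c, c' : G → M` with the same restriction to `N` differ by a coboundary: `c − c'` is a cocycle
vanishing on `N`. So the class of a cocycle in `H¹(G, M)` is determined by the HOMOMORPHISM
`c|_N : N → M` — "restriction `H¹(G_S, 𝒯_e) → Hom_G(G_{L₀}, 𝒯_e)` is injective (independent of cocycle
representatives)". [folklore] -/
theorem restriction_injective_of_central_scalar (c c' : G → M)
    (hc : ∀ g h : G, c (g * h) = c g + ρ g (c h)) (hc' : ∀ g h : G, c' (g * h) = c' g + ρ g (c' h))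
    (N : Subgroup G) (hcc' : ∀ n ∈ N, c n = c' n)
    (z : G) (hz : ∀ g : G, ∃ n ∈ N, z * g = g * z * n)
    (lam : Ωˣ) (hρz : ∀ m : M, ρ z m = (lam : Ω) • m) (hlam : IsUnit ((lam : Ω) - 1)) :
    ∃ m : M, ∀ g : G, c g - c' g = ρ g m - m := by
  have hd : ∀ g h : G, (c - c') (g * h) = (c - c') g + ρ g ((c - c') h) := by
    intro g h
    simp only [Pi.sub_apply, hc, hc', map_sub]
    abel
  have hdN : ∀ n ∈ N, (c - c') n = 0 := fun n hn => by simp [hcc' n hn]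
  refine ⟨hlam.unit⁻¹.val • (c - c') z, fun g => ?_⟩
  have := cocycle_eq_coboundary_of_central_scalar ρ (c - c') hd N hdN z hz lam hρz hlam g
  simpa only [Pi.sub_apply] using this

end Summit.BirchSwinnertonDyer.BirchSwinnertonDyer.Rank1Residual.KolyvaginClass
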